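/-
Origin: expansion seat `prover-pub-hodgecm-mc-binder-2-g17-0`, handover #88 2026-08-20T19:45Z md5 19192a5fb4be (NEW; 381 l.; r2 = r1 + ns `HodgeCM.LiuJunction` (axioms-1-g15 Part A verbatim, 9 decls, author planner-pub-hodgecm-mc-axioms-1-g15-0); ns `HodgeCM.IsotypicSummand`; Schur-summand algebra over ANY ring `R` for a MULTIPLICITY-FREE decomposition into pairwise non-isomorphic simples — the printed shape of [Liu21] Prop 4.13 «`≅ ⊕ ω(t)`» + Thm 4.18 (2) «mutually non-isomorphic»: external form `component_comp_eq_zero` ∕ `range_le_range_lof` ∕ `range_le_map_symm_of_linearEquiv (e : M ≃ₗ[R] ⨁ j, W j) (ψ : S →ₗ[R] M) : range ψ ≤ (range (lof R ι W i₀)).map e.symm`; internal form `range_le_of_isInternal (hH : DirectSum.IsInternal H) : range ψ ≤ H i₀` ∕ `range_le_of_iSupIndep` ∕ `mem_of_isInternal_of_mem_range`; multiplicity one `isotypicComponent_eq_of_isInternal : isotypicComponent R M (H i₀) = H i₀` ∕ `le_of_isInternal_of_linearEquiv`; μ-BLOCK forms `iSup_range_le_biSup_of_isInternal` ∕ `sum_mem_biSup_of_isInternal`;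 BLOCK EQUALITY `isSemisimpleModule_of_isInternal` ∕ `le_biSup_of_isInternal_of_simples` ∕ `le_of_isInternal_of_exists_le` ∕ `exists_linearEquiv_of_injective` ∕ `eq_biSup_of_isInternal_of_linearEquiv (e : N ≃ₗ[R] ⨁ t : B, W t) : N = ⨆ i ∈ B, H i` (Thm 4.18's abstract iso + the injective pull-back (4.3) ⇒ «image of (4.3) = the μ-block»). All [folklore] from Mathlib's `LinearMap.bijective_or_eq_zero`. CERT: hub `lean check` rc 0 ∕ 0 warn; lane farm lean-direct (`-DautoImplicit=false`, RUN-59∕60 PKG toolchain) rc 0 ∕ 3 s ∕ 0 warn ∕ proof holes 0 (`g17/farm/logs/summary.tsv`); `#print axioms` 25 ∕ 25 ⊆ trio (`g17/farm/logs/ax_iso.log` 244540e17921); farm rc 0 ∕ 25 s; FQN scan: ns `HodgeCM.IsotypicSummand` absent from PKG lists 9e372979b8a0 (13 216) + sources, 0 collisions; NAME LIST: `HodgeCM.IsotypicSummand.range_le_of_isInternal` · `HodgeCM.LiuJunction.summand_le_of_equiv` · `HodgeCM.IsotypicSummand.eq_biSup_of_isInternal_of_linearEquiv`) (`HOME/mc/pub-hodgecm-mc-binder-2/g17/stage61/HodgeCM/Model/Binders/IsotypicSummand.lean`,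 md5 19192a5fb4be, 381 lines);
landed by the gen-25 packager (p-g25) in gate run 61 as `HodgeCM/Model/Binders/IsotypicSummand.lean` (verbatim).
-/
/-
binder-2 lane (unit pub-hodgecm-mc-binder-2-g17, seat prover-pub-hodgecm-mc-binder-2-g17-0), 2026-08-20.
(J-Liu-Θ) junction behind E's row 9 `hΘ` — offer (O3): the ALGEBRA between
«the Hecke-span of a theta class is a quotient of ω(μ,ε,χ)^K» ((J2)+(J4)) and
«it lies in the μ-block of [Liu21] Prop 4.13 / Thm 4.18» — generic, carrier-choice independent.
Imports Mathlib only. No `Prop` is minted; nothing of E / row 9 / MODEL-N is touched.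
-/
import Mathlib.RingTheory.SimpleModule.Isotypic
import Mathlib.Algebra.DirectSum.Module

/-!
# Isotypic summands of a multiplicity-free decomposition into pairwise non-isomorphic simples

Pure module algebra over an ARBITRARY ring `R` (so it applies verbatim to `R = ℋ(G//K)` (Hecke algebra at
fixed level), to the `ℂ`-algebra `R_Γ` generated by the model's `heckeOpModel … g`, or to `R = ℂ[G(𝔸_f)]`
on the tower — whichever carrier the cell chooses for (α4)).

The printed shape of [Liu21, Prop. 4.13] is an isomorphism of modules `H ≅ ⊕_t ω(t)` with every summand
IRREDUCIBLE, and [Liu21, Thm. 4.18 (2)] says the summands are MUTUALLY NON-ISOMORPHIC.  In that situation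
Schur's lemma pins every map from a simple module of the type of ONE summand into that summand:

* `component_comp_eq_zero`, `range_le_range_lof` — external form `⨁ i, W i`: an `R`-linear map from a
  simple module `S` that is isomorphic to no `W i` with `i ≠ i₀` has all components `i ≠ i₀` equal to
  zero, hence lands in the `i₀`-th summand;
* `range_le_map_symm_of_linearEquiv` — the same through an isomorphism `e : M ≃ₗ[R] ⨁ i, W i`
  (the literal shape of Prop. 4.13);
* `range_le_of_isInternal`, `range_le_of_iSupIndep` — internal form (`DirectSum.IsInternal H`, resp.
  `iSupIndep H ∧ iSup H = ⊤`) for a family of simple submodules `H : ι → Submodule R M`;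
* `isotypicComponent_eq_of_isInternal` — multiplicity one: Mathlib's `isotypicComponent R M (H i₀) = H i₀`;
* `mem_of_isInternal_of_mem_range` / `iSup_range_le_biSup_of_isInternal` — the consumer forms: a vector in
  the range of a map from the `i₀`-type lies in `H i₀`; finitely or infinitely many maps `ψ j` from types
  `t j` of a block `B ⊆ ι` (the μ-block of Thm. 4.18: all `(μ, ε, χ)` with the given `μ`) have
  `⨆ j, range (ψ j) ≤ ⨆ i ∈ B, H i` (the case of a theta space spanned by lifts `θ_φ(χ)` of several `χ`);
* `le_biSup_of_isInternal_of_simples` / `le_of_isInternal_of_exists_le` / `eq_biSup_of_isInternal_of_linearEquiv` —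
  BLOCK EQUALITY: a submodule `N ≃ₗ[R] ⨁_{t ∈ B} W t` (`W t ≃ H t`) IS the internal block `⨆ i ∈ B, H i` — the step
  from Thm. 4.18's abstract isomorphism `Ω(μ) ⊗_{M_μ} ℂ ≅ ⊕_{ε,χ} ω(μ,ε,χ)`, realised inside `H¹_{B,τ'}(A_∞, ℂ)` by the
  injective pull-back map (4.3), to «image of (4.3) = the μ-block of Prop. 4.13»;
* `exists_linearEquiv_of_injective` — a simple module embedding in `⨁ t, W t` is isomorphic to some `W t`;
* namespace `HodgeCM.LiuJunction` (end of file) — Part A of axioms-1-g15's `LiuDictionary` spec MERGED verbatim (J3-DESIGN §6):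
  the `summand e t` API (`apply_mem_summand`, `summand_le_of_equiv`, `range_le_of_equiv`, `component_eq_zero_of_mem_iSup`,
  `eq_sum_of_mem_iSup`) consumed unchanged by the dictionary's junction theorem `subset_span_of_liuDictionary`.

All statements are [folklore] consequences of Schur's lemma (`LinearMap.bijective_or_eq_zero`).
-/

namespace HodgeCM.IsotypicSummand

open DirectSum

section External

variable {R : Type*} [Ring R] {ι : Type*} [DecidableEq ι]
  {W : ι → Type*} [∀ i, AddCommGroup (W i)] [∀ i, Module R (W i)]
  {S : Type*} [AddCommGroup S] [Module R S]
  {M : Type*} [AddCommGroup M] [Module R M]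

omit [DecidableEq ι] in
/-- Schur: a map from a simple module `S` into `⨁ i, W i` (all `W i` simple) has ZERO `i`-th component for
every `i ≠ i₀`, provided `S` is isomorphic to no `W i` with `i ≠ i₀`. [folklore] -/
theorem component_comp_eq_zero [IsSimpleModule R S] [∀ i, IsSimpleModule R (W i)] {i₀ : ι}
    (hS : ∀ ⦃i : ι⦄, Nonempty (S ≃ₗ[R] W i) → i = i₀) {i : ι} (hi : i ≠ i₀)
    (ψ : S →ₗ[R] ⨁ j, W j) : component R ι W i ∘ₗ ψ = 0 :=
  (component R ι W i ∘ₗ ψ).bijective_or_eq_zero.elim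
    (fun h => absurd (hS ⟨LinearEquiv.ofBijective _ h⟩) hi) id

omit [DecidableEq ι] in
/-- Pointwise form of `component_comp_eq_zero`. [folklore] -/
theorem component_apply_eq_zero [IsSimpleModule R S] [∀ i, IsSimpleModule R (W i)] {i₀ : ι}
    (hS : ∀ ⦃i : ι⦄, Nonempty (S ≃ₗ[R] W i) → i = i₀) {i : ι} (hi : i ≠ i₀)
    (ψ : S →ₗ[R] ⨁ j, W j) (s : S) : component R ι W i (ψ s) = 0 := by
  have h := LinearMap.congr_fun (component_comp_eq_zero hS hi ψ) s
  rwa [LinearMap.comp_apply, LinearMap.zero_apply] at h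

/-- A map from a simple module of the `i₀`-th type into `⨁ i, W i` (simple, and `S ≄ W i` for `i ≠ i₀`)
lands in the `i₀`-th summand. [folklore] -/
theorem range_le_range_lof [IsSimpleModule R S] [∀ i, IsSimpleModule R (W i)] {i₀ : ι}
    (hS : ∀ ⦃i : ι⦄, Nonempty (S ≃ₗ[R] W i) → i = i₀) (ψ : S →ₗ[R] ⨁ j, W j) :
    LinearMap.range ψ ≤ LinearMap.range (lof R ι W i₀) := by
  rintro _ ⟨s, rfl⟩
  refine ⟨component R ι W i₀ (ψ s), ext_component R fun i => ?_⟩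
  by_cases hi : i = i₀
  · rw [hi, component.lof_self]
  · rw [component.of, dif_neg (Ne.symm hi), component_apply_eq_zero hS hi ψ s]

/-- The same through an isomorphism `e : M ≃ₗ[R] ⨁ i, W i` — the literal shape of [Liu21, Prop. 4.13]
«`H¹ ≅ ⊕_t ω(t)`»: a map from a simple module of the `i₀`-th type into `M` lands in the `i₀`-th summand
`e⁻¹(W i₀)`. [folklore] -/
theorem range_le_map_symm_of_linearEquiv [IsSimpleModule R S] [∀ i, IsSimpleModule R (W i)] {i₀ : ι}
    (hS : ∀ ⦃i : ι⦄, Nonempty (S ≃ₗ[R] W i) → i = i₀) (e : M ≃ₗ[R] ⨁ j, W j) (ψ : S →ₗ[R] M) :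
    LinearMap.range ψ ≤
      (LinearMap.range (lof R ι W i₀)).map ((e.symm : (⨁ j, W j) ≃ₗ[R] M) : (⨁ j, W j) →ₗ[R] M) := by
  rintro _ ⟨s, rfl⟩
  obtain ⟨b, hb⟩ := range_le_range_lof hS ((e : M →ₗ[R] ⨁ j, W j) ∘ₗ ψ) ⟨s, rfl⟩
  refine ⟨lof R ι W i₀ b, ⟨b, rfl⟩, ?_⟩
  rw [hb, LinearMap.comp_apply, LinearEquiv.coe_coe, LinearEquiv.coe_coe, LinearEquiv.symm_apply_apply]

end External

section Internal

variable {R : Type*} [Ring R] {M : Type*} [AddCommGroup M] [Module R M] {ι : Type*} [DecidableEq ι]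
  (H : ι → Submodule R M) {S : Type*} [AddCommGroup S] [Module R S]

/-- INTERNAL form: `M = ⨁ i, H i` (`DirectSum.IsInternal H`) with every `H i` simple; a map from a
simple module `S` with `S ≄ H i` for `i ≠ i₀` has range inside `H i₀`. [folklore] -/
theorem range_le_of_isInternal (hH : IsInternal H) [IsSimpleModule R S]
    [∀ i, IsSimpleModule R (H i)] {i₀ : ι} (hS : ∀ ⦃i : ι⦄, Nonempty (S ≃ₗ[R] H i) → i = i₀)
    (ψ : S →ₗ[R] M) : LinearMap.range ψ ≤ H i₀ := by
  intro x hx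
  obtain ⟨y, ⟨b, rfl⟩, rfl⟩ :=
    range_le_map_symm_of_linearEquiv hS (LinearEquiv.ofBijective (coeLinearMap H) hH).symm ψ hx
  rw [LinearEquiv.symm_symm, LinearEquiv.coe_coe, LinearEquiv.ofBijective_apply, coeLinearMap_lof]
  exact b.2

/-- INTERNAL form with the decomposition given as an independent family spanning `M`. [folklore] -/
theorem range_le_of_iSupIndep (hind : iSupIndep H) (htop : iSup H = ⊤) [IsSimpleModule R S]
    [∀ i, IsSimpleModule R (H i)] {i₀ : ι} (hS : ∀ ⦃i : ι⦄, Nonempty (S ≃ₗ[R] H i) → i = i₀)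
    (ψ : S →ₗ[R] M) : LinearMap.range ψ ≤ H i₀ :=
  range_le_of_isInternal H (isInternal_submodule_of_iSupIndep_of_iSup_eq_top hind htop) hS ψ

/-- MEMBERSHIP form: a vector hit by a map from a simple module of the `i₀`-th type lies in `H i₀`.
[folklore] -/
theorem mem_of_isInternal_of_mem_range (hH : IsInternal H) [IsSimpleModule R S]
    [∀ i, IsSimpleModule R (H i)] {i₀ : ι} (hS : ∀ ⦃i : ι⦄, Nonempty (S ≃ₗ[R] H i) → i = i₀)
    (ψ : S →ₗ[R] M) {v : M} (hv : v ∈ LinearMap.range ψ) : v ∈ H i₀ :=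
  range_le_of_isInternal H hH hS ψ hv

/-- MULTIPLICITY ONE: in an internal direct sum of PAIRWISE NON-ISOMORPHIC simple submodules, Mathlib's
isotypic component of the type `H i₀` is `H i₀` itself. [folklore] -/
theorem isotypicComponent_eq_of_isInternal (hH : IsInternal H) [∀ i, IsSimpleModule R (H i)]
    (hW : ∀ ⦃i j : ι⦄, Nonempty (H i ≃ₗ[R] H j) → i = j) (i₀ : ι) :
    isotypicComponent R M (H i₀) = H i₀ := by
  refine le_antisymm (sSup_le fun m hm => ?_) (Submodule.le_isotypicComponent _)
  obtain ⟨e⟩ := hm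
  haveI : IsSimpleModule R m := IsSimpleModule.congr e
  have h := range_le_of_isInternal H hH (S := m) (i₀ := i₀)
    (fun _ hi => (hW ⟨e.symm.trans (Classical.choice hi)⟩).symm) m.subtype
  rwa [Submodule.range_subtype] at h

/-- A simple SUBMODULE isomorphic to `H i₀` is contained in (indeed equals) `H i₀`. [folklore] -/
theorem le_of_isInternal_of_linearEquiv (hH : IsInternal H) [∀ i, IsSimpleModule R (H i)]
    (hW : ∀ ⦃i j : ι⦄, Nonempty (H i ≃ₗ[R] H j) → i = j) {i₀ : ι} (m : Submodule R M)
    (e : m ≃ₗ[R] H i₀) : m ≤ H i₀ :=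
  (le_sSup (s := {m : Submodule R M | Nonempty (m ≃ₗ[R] H i₀)}) ⟨e⟩).trans
    (isotypicComponent_eq_of_isInternal H hH hW i₀).le

/-- BLOCK form (the μ-block of [Liu21, Thm. 4.18]): maps `ψ j` from simple modules `S j` of types `t j`
lying in a block `B ⊆ ι` have `⨆ j, range (ψ j) ≤ ⨆ i ∈ B, H i` — e.g. a theta space spanned by the lifts
`θ_φ(χ)` of several characters `χ`, all with the same first entry `μ`. [folklore] -/
theorem iSup_range_le_biSup_of_isInternal (hH : IsInternal H) [∀ i, IsSimpleModule R (H i)]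
    (hW : ∀ ⦃i j : ι⦄, Nonempty (H i ≃ₗ[R] H j) → i = j) {J : Type*} {S : J → Type*}
    [∀ j, AddCommGroup (S j)] [∀ j, Module R (S j)] [∀ j, IsSimpleModule R (S j)]
    (t : J → ι) (e : ∀ j, S j ≃ₗ[R] H (t j)) (ψ : ∀ j, S j →ₗ[R] M) {B : Set ι}
    (hB : ∀ j, t j ∈ B) : ⨆ j, LinearMap.range (ψ j) ≤ ⨆ i ∈ B, H i :=
  iSup_le fun j =>
    (range_le_of_isInternal H hH (S := S j) (i₀ := t j)
        (fun _ hi => (hW ⟨(e j).symm.trans (Classical.choice hi)⟩).symm) (ψ j)).trans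
      (le_biSup H (hB j))

/-- BLOCK form, membership: a finite sum `Σ_j v j` with `v j ∈ range (ψ j)` lies in `⨆ i ∈ B, H i`.
[folklore] -/
theorem sum_mem_biSup_of_isInternal (hH : IsInternal H) [∀ i, IsSimpleModule R (H i)]
    (hW : ∀ ⦃i j : ι⦄, Nonempty (H i ≃ₗ[R] H j) → i = j) {J : Type*} {S : J → Type*}
    [∀ j, AddCommGroup (S j)] [∀ j, Module R (S j)] [∀ j, IsSimpleModule R (S j)]
    (t : J → ι) (e : ∀ j, S j ≃ₗ[R] H (t j)) (ψ : ∀ j, S j →ₗ[R] M) {B : Set ι}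
    (hB : ∀ j, t j ∈ B) (s : Finset J) (v : J → M) (hv : ∀ j ∈ s, v j ∈ LinearMap.range (ψ j)) :
    ∑ j ∈ s, v j ∈ ⨆ i ∈ B, H i :=
  Submodule.sum_mem _ fun j hj =>
    iSup_range_le_biSup_of_isInternal H hH hW t e ψ hB (Submodule.mem_iSup_of_mem j (hv j hj))

/-! ### Blocks: a submodule built from types in `B` lies in, and a copy-containing submodule contains, the `B`-block -/

/-- The ambient module of an internal direct sum of simples is semisimple. [folklore] -/
theorem isSemisimpleModule_of_isInternal (hH : IsInternal H) [∀ i, IsSimpleModule R (H i)] :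
    IsSemisimpleModule R M :=
  isSemisimpleModule_of_isSemisimpleModule_submodule' (fun _ => inferInstance) hH.submodule_iSup_eq_top

/-- A submodule ALL of whose simple submodules are of types in `B` lies in the `B`-block `⨆ i ∈ B, H i`.
[folklore] -/
theorem le_biSup_of_isInternal_of_simples (hH : IsInternal H) [∀ i, IsSimpleModule R (H i)]
    (hW : ∀ ⦃i j : ι⦄, Nonempty (H i ≃ₗ[R] H j) → i = j) (N : Submodule R M) {B : Set ι}
    (hN : ∀ S : Submodule R M, S ≤ N → IsSimpleModule R S → ∃ i ∈ B, Nonempty (S ≃ₗ[R] H i)) :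
    N ≤ ⨆ i ∈ B, H i := by
  haveI := isSemisimpleModule_of_isInternal H hH
  rw [← IsSemisimpleModule.sSup_simples_le N]
  refine sSup_le fun S hS => ?_
  obtain ⟨i, hi, ⟨e⟩⟩ := hN S hS.2 hS.1
  exact (le_of_isInternal_of_linearEquiv H hH hW S e).trans (le_biSup H hi)

/-- A summand `H i` of which `N` contains an isomorphic copy lies in `N` (the copy IS `H i`). [folklore] -/
theorem le_of_isInternal_of_exists_le (hH : IsInternal H) [∀ i, IsSimpleModule R (H i)]
    (hW : ∀ ⦃i j : ι⦄, Nonempty (H i ≃ₗ[R] H j) → i = j) (N : Submodule R M) {i : ι}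
    (h : ∃ S ≤ N, Nonempty (S ≃ₗ[R] H i)) : H i ≤ N := by
  obtain ⟨S, hSN, ⟨e⟩⟩ := h
  have hle : S ≤ H i := le_of_isInternal_of_linearEquiv H hH hW S e
  haveI : IsSimpleModule R S := IsSimpleModule.congr e
  have hS : S ≠ ⊥ := (Submodule.nontrivial_iff_ne_bot).mp (IsSimpleModule.nontrivial R S)
  have hSi : S = H i := ((isSimpleModule_iff_isAtom.mp inferInstance).le_iff_eq hS).mp hle
  exact hSi ▸ hSN

/-- A simple module mapping INJECTIVELY into `⨁ t, W t` (all `W t` simple) is isomorphic to some `W t`: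
some component of the map is non-zero, hence bijective by Schur. [folklore] -/
theorem exists_linearEquiv_of_injective {κ : Type*} {W : κ → Type*} [∀ t, AddCommGroup (W t)]
    [∀ t, Module R (W t)] [∀ t, IsSimpleModule R (W t)] [IsSimpleModule R S]
    (ψ : S →ₗ[R] ⨁ t, W t) (hψ : Function.Injective ψ) : ∃ t, Nonempty (S ≃ₗ[R] W t) := by
  by_contra h
  have hzero : ∀ t, component R κ W t ∘ₗ ψ = 0 := fun t =>
    (component R κ W t ∘ₗ ψ).bijective_or_eq_zero.elim
      (fun hb => absurd ⟨t, ⟨LinearEquiv.ofBijective _ hb⟩⟩ h) id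
  haveI := IsSimpleModule.nontrivial R S
  obtain ⟨s, hs⟩ := exists_ne (0 : S)
  apply hs
  apply hψ
  rw [map_zero]
  refine ext_component R fun t => ?_
  have := LinearMap.congr_fun (hzero t) s
  rw [LinearMap.comp_apply, LinearMap.zero_apply] at this
  rw [this, map_zero]

/-- **BLOCK EQUALITY.**  In an internal direct sum of pairwise non-isomorphic simples, a submodule `N` that is
ISOMORPHIC to the external `B`-block `⨁_{t ∈ B} W t` (`W t ≃ H t`) IS the internal `B`-block `⨆ i ∈ B, H i` — the
algebra turning [Liu21, Thm. 4.18]'s abstract isomorphism `Ω(μ) ⊗_{M_μ} ℂ ≅ ⊕_{ε,χ} ω(μ,ε,χ)`, realised INSIDE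
`H¹_{B,τ'}(A_∞, ℂ)` by the injective pull-back map (4.3), into «image of (4.3) = the μ-block of Prop. 4.13».
[folklore] -/
theorem eq_biSup_of_isInternal_of_linearEquiv (hH : IsInternal H) [∀ i, IsSimpleModule R (H i)]
    (hW : ∀ ⦃i j : ι⦄, Nonempty (H i ≃ₗ[R] H j) → i = j) (N : Submodule R M) {B : Set ι}
    {W : B → Type*} [∀ t, AddCommGroup (W t)] [∀ t, Module R (W t)]
    (eW : ∀ t : B, W t ≃ₗ[R] H (t : ι)) (e : N ≃ₗ[R] ⨁ t : B, W t) : N = ⨆ i ∈ B, H i := by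
  classical
  haveI : ∀ t : B, IsSimpleModule R (W t) := fun t => IsSimpleModule.congr (eW t)
  refine le_antisymm (le_biSup_of_isInternal_of_simples H hH hW N fun S hSN hS => ?_) ?_
  · -- a simple `S ≤ N` embeds into `⨁ W t`, hence is `≃ W t ≃ H t` for some `t ∈ B`
    haveI := hS
    obtain ⟨t, ⟨e'⟩⟩ := exists_linearEquiv_of_injective
      ((e : N →ₗ[R] ⨁ t : B, W t) ∘ₗ Submodule.inclusion hSN)
      (e.injective.comp (Submodule.inclusion_injective hSN))
    exact ⟨t, t.2, ⟨e'.trans (eW t)⟩⟩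
  · -- every `H i`, `i ∈ B`, has a copy inside `N`: the image of `W ⟨i, hi⟩`
    refine iSup₂_le fun i hi => le_of_isInternal_of_exists_le H hH hW N ?_
    let φ : W ⟨i, hi⟩ →ₗ[R] M :=
      N.subtype ∘ₗ (e.symm : (⨁ t : B, W t) →ₗ[R] N) ∘ₗ lof R B W ⟨i, hi⟩
    have hφ : Function.Injective φ :=
      N.subtype_injective.comp (e.symm.injective.comp DFinsupp.single_injective)
    refine ⟨LinearMap.range φ, ?_, ⟨(LinearEquiv.ofInjective φ hφ).symm.trans (eW ⟨i, hi⟩)⟩⟩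
    rintro _ ⟨w, rfl⟩
    exact (((e.symm : (⨁ t : B, W t) →ₗ[R] N) ∘ₗ lof R B W ⟨i, hi⟩) w).2

end Internal

end HodgeCM.IsotypicSummand

/-! ### Part A of axioms-1-g15's `LiuDictionary` spec (J3-DESIGN §2 / §6, `mc/pub-hodgecm-mc-axioms-1-g15/lean/J3/HodgeCM/Model/LiuDictionary.lean`
a52fa65292bf ll. 78–194), MERGED here verbatim (namespace `HodgeCM.LiuJunction` kept, so the dictionary's Part D consumes it unchanged):
the `summand e t := range (e.symm ∘ lof t)` API over a decomposition `e : H ≃ₗ[A] ⨁ t, Ω t` — `apply_mem_summand` (= `range_le_map_symm_of_linearEquiv`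
above), `summand_le_of_equiv` (how Thm 4.18's displayed isomorphism is USED: a submodule `N ≃ ⨁_a Ω_{ι a}` CONTAINS the summands `Ω_{ι a}`),
`range_le_of_equiv`, and the finite-support bookkeeping `component_eq_zero_of_mem_iSup` / `eq_sum_of_mem_iSup` (the `s`-components of a `K`-fixed
vector are its `A`-linear projections). Author of these nine declarations: planner-pub-hodgecm-mc-axioms-1-g15-0. [folklore] -/

namespace HodgeCM

namespace LiuJunction

open scoped DirectSum

variable {A : Type*} [Ring A] {H : Type*} [AddCommGroup H] [Module A H]
  {T : Type*} {Ω : T → Type*} [∀ t, AddCommGroup (Ω t)] [∀ t, Module A (Ω t)]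

/-- The `t`-th summand of `H`, transported along a decomposition `e : H ≃ ⨁_t Ω_t`. [folklore] -/
noncomputable def summand [DecidableEq T] (e : H ≃ₗ[A] ⨁ t, Ω t) (t : T) : Submodule A H :=
  LinearMap.range (e.symm.toLinearMap ∘ₗ DirectSum.lof A T Ω t)

/-- (Ported verbatim from the HodgeCMPerL package; no docstring in the source.) -/
theorem injective_symm_comp_lof [DecidableEq T] (e : H ≃ₗ[A] ⨁ t, Ω t) (t : T) :
    Function.Injective (e.symm.toLinearMap ∘ₗ DirectSum.lof A T Ω t) := by
  intro x y h
  exact DirectSum.of_injective (β := fun t => Ω t) t (e.symm.injective h)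

/-- Each summand is isomorphic to `Ω_t`, hence simple when `Ω_t` is. [folklore] -/
theorem isSimpleModule_summand [DecidableEq T] [∀ t, IsSimpleModule A (Ω t)] (e : H ≃ₗ[A] ⨁ t, Ω t) (t : T) :
    IsSimpleModule A (summand e t) :=
  IsSimpleModule.congr (LinearEquiv.ofInjective _ (injective_symm_comp_lof e t)).symm

/-- **Schur**: an `A`-map from `Ω_t` into `H` has zero `t'`-component for `t' ≠ t`, the `Ω`'s being pairwise non-isomorphic
simple modules. [folklore] -/
theorem component_apply_eq_zero [∀ t, IsSimpleModule A (Ω t)]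
    (hsep : ∀ t t', Nonempty (Ω t ≃ₗ[A] Ω t') → t = t')
    (e : H ≃ₗ[A] ⨁ t, Ω t) {t t' : T} (h : t ≠ t') (ψ : Ω t →ₗ[A] H) (y : Ω t) :
    DirectSum.component A T Ω t' (e (ψ y)) = 0 := by
  rcases LinearMap.bijective_or_eq_zero (DirectSum.component A T Ω t' ∘ₗ e.toLinearMap ∘ₗ ψ) with hb | hb
  · exact absurd (hsep t t' ⟨LinearEquiv.ofBijective _ hb⟩) h
  · simpa using LinearMap.congr_fun hb y

/-- … hence it lands in the `t`-th summand. [folklore] -/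
theorem apply_mem_summand [DecidableEq T] [∀ t, IsSimpleModule A (Ω t)]
    (hsep : ∀ t t', Nonempty (Ω t ≃ₗ[A] Ω t') → t = t')
    (e : H ≃ₗ[A] ⨁ t, Ω t) {t : T} (ψ : Ω t →ₗ[A] H) (y : Ω t) :
    ψ y ∈ summand e t := by
  refine ⟨DirectSum.component A T Ω t (e (ψ y)), ?_⟩
  simp only [LinearMap.coe_comp, Function.comp_apply, LinearEquiv.coe_coe]
  apply e.injective
  rw [LinearEquiv.apply_symm_apply]
  refine DirectSum.ext_component A (fun t' => ?_)
  by_cases ht : t = t'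
  · subst ht
    rw [DirectSum.component.lof_self]
  · rw [DirectSum.component.of, dif_neg ht, component_apply_eq_zero hsep e ht ψ y]

/-- **Multiplicity one, used**: a submodule `N ≅ ⨁_a Ω_{ι a}` CONTAINS the summands `Ω_{ι a}` of `H`. [folklore] -/
theorem summand_le_of_equiv [DecidableEq T] [∀ t, IsSimpleModule A (Ω t)]
    (hsep : ∀ t t', Nonempty (Ω t ≃ₗ[A] Ω t') → t = t')
    (e : H ≃ₗ[A] ⨁ t, Ω t) {S : Type*} [DecidableEq S] (ι : S → T) (N : Submodule A H)
    (φ : (⨁ a : S, Ω (ι a)) ≃ₗ[A] N) (a : S) : summand e (ι a) ≤ N := by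
  let ψ : Ω (ι a) →ₗ[A] H := N.subtype ∘ₗ φ.toLinearMap ∘ₗ DirectSum.lof A S (fun a => Ω (ι a)) a
  have hψN : LinearMap.range ψ ≤ N := by
    rintro _ ⟨y, rfl⟩
    exact (φ _).2
  have hψW : LinearMap.range ψ ≤ summand e (ι a) := by
    rintro _ ⟨y, rfl⟩
    exact apply_mem_summand hsep e ψ y
  have hinj : Function.Injective ψ := by
    intro x y hxy
    exact DirectSum.of_injective (β := fun a => Ω (ι a)) a (φ.injective (Subtype.val_injective hxy))
  have hψ0 : LinearMap.range ψ ≠ ⊥ := by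
    haveI : Nontrivial (Ω (ι a)) := IsSimpleModule.nontrivial A (Ω (ι a))
    obtain ⟨y, hy⟩ := exists_ne (0 : Ω (ι a))
    intro hbot
    have hy0 : ψ y ∈ (⊥ : Submodule A H) := hbot ▸ LinearMap.mem_range_self ψ y
    rw [Submodule.mem_bot] at hy0
    exact hy (hinj (hy0.trans (map_zero ψ).symm))
  haveI : IsSimpleModule A (summand e (ι a)) := isSimpleModule_summand e (ι a)
  have hatom : IsAtom (summand e (ι a)) := isSimpleModule_iff_isAtom.1 ‹_›
  rcases hatom.le_iff.1 hψW with h | h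
  · exact absurd h hψ0
  · exact h ▸ hψN

/-- The range of an `A`-map `Ω_{ι a} → H` lies in any submodule `N ≅ ⨁_a Ω_{ι a}`. [folklore] -/
theorem range_le_of_equiv [DecidableEq T] [∀ t, IsSimpleModule A (Ω t)]
    (hsep : ∀ t t', Nonempty (Ω t ≃ₗ[A] Ω t') → t = t')
    (e : H ≃ₗ[A] ⨁ t, Ω t) {S : Type*} [DecidableEq S] (ι : S → T) (N : Submodule A H)
    (φ : (⨁ a : S, Ω (ι a)) ≃ₗ[A] N) (a : S) (ψ : Ω (ι a) →ₗ[A] H) : LinearMap.range ψ ≤ N := by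
  rintro _ ⟨y, rfl⟩
  exact summand_le_of_equiv hsep e ι N φ a (apply_mem_summand hsep e ψ y)

/-- Components outside `s` of an element of `⨆_{t ∈ s}` (summands) vanish. [folklore] -/
theorem component_eq_zero_of_mem_iSup [DecidableEq T] (e : H ≃ₗ[A] ⨁ t, Ω t) (s : Finset T) {x : H}
    (hx : x ∈ ⨆ t ∈ s, summand e t) {t' : T} (ht' : t' ∉ s) :
    DirectSum.component A T Ω t' (e x) = 0 := by
  suffices h : (⨆ t ∈ s, summand e t) ≤ LinearMap.ker (DirectSum.component A T Ω t' ∘ₗ e.toLinearMap) by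
    simpa using h hx
  refine iSup₂_le fun t ht => ?_
  rintro _ ⟨y, rfl⟩
  simp only [LinearMap.mem_ker, LinearMap.coe_comp, Function.comp_apply, LinearEquiv.coe_coe,
    LinearEquiv.apply_symm_apply]
  rw [DirectSum.component.of, dif_neg]
  rintro rfl
  exact ht' ht

/-- An element of `⨆_{t ∈ s}` (summands) is the sum of its `s`-components. [folklore] -/
theorem eq_sum_of_mem_iSup [DecidableEq T] (e : H ≃ₗ[A] ⨁ t, Ω t) (s : Finset T) {x : H}
    (hx : x ∈ ⨆ t ∈ s, summand e t) :
    x = ∑ t ∈ s, e.symm (DirectSum.lof A T Ω t (DirectSum.component A T Ω t (e x))) := by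
  apply e.injective
  rw [map_sum]
  simp_rw [LinearEquiv.apply_symm_apply]
  refine DirectSum.ext_component A (fun t' => ?_)
  rw [map_sum]
  by_cases ht' : t' ∈ s
  · rw [Finset.sum_eq_single t']
    · rw [DirectSum.component.lof_self]
    · intro t _ htne
      rw [DirectSum.component.of, dif_neg htne]
    · intro h
      exact absurd ht' h
  · rw [component_eq_zero_of_mem_iSup e s hx ht', Finset.sum_eq_zero]
    intro t ht
    rw [DirectSum.component.of, dif_neg]
    rintro rfl
    exact ht' ht

end LiuJunction

end HodgeCM
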